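import Summits.QuantumFields.YangMills.Theorems.UnitScaleTiltProp7SectET3N06LeavesRelZ
import Summits.QuantumFields.YangMills.Theorems.UnitScaleTiltProp7SectET3G0LayerFromThm310
import HarnessLib

/-!
# Route `UnitScaleTilt`, crux «MinimiserStabilityRegPr» (stmt-QuantumFields-19200, v10 stub EX, route (α), node N06(d = 3)) — OWNER W-SEAT MAP #3 FILE C IN THE REPAIRED (Z) LETTER SPECIES:
# **THE T³ LEAF AND THE `norm_G` ROW WITH THE «THEOREM 3.3 FOR G₀» LAYER DISCHARGED BY THEOREM 3.10's SCHEMAS — the DEPMAP edge «N06(d = 3) → norm_G» as ONE kernel statement**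

Cell `ym3-torus` (HUMAN RULING D-0037, YM ladder rung R3 — NOT the Clay problem), width seat ym-ust-20520-w1 g3.  Count-neutral helper (`--supports stmt-QuantumFields-19200 --as
helper`); registry untouched; THEOREMS ONLY (0 `def`, 0 `sorry`); NOTHING of [Balaban1985BackgroundPropagators] is asserted.

THE COMPOSITION.  `Prop7SectET3N06LeavesRelZ.t313_of_pins_T3_relZ` (p603926) displays the
«Theorem 3.3 for G₀» layer in `hmodel`∕`hleft`; `Prop7SectET3G0LayerFromThm310.g0_layer_T3_of_thm310_schemas` (file B) derives that layer from Theorem 3.10's walk-expansion schemas for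
`G(U) = G₀` (p. 421) with every threshold and constant chosen.  §1 `t313_of_pins_T3_relZ_fromThm310` plugs the second into the first (thresholds ∕ radii are file B's `(M₀, a₀)`; the displayed
families at `(M12, a12)` restrict to it; the G₀D entry `hgD12` of file B is `hletters`' own `gD2` field; the `hlen` proofs agree by proof irrelevance); §2 `normG_row_of_thm310ObligationsZ`
= §1 ∘ `Prop7SectET3NormG.normG_row_of_t313_classTransfer` (✓ p600795) at the band `b₀ = b₁ = 1`.
STATE OF THE EDGE AFTER THIS FILE (by name): `norm_G` row ⇐ {Theorem 3.10's schemas `Local342G`∕`Factors389`∕`Identities310` + legs for `G₀,□` at curved U = Cor. 3.6 per cube + (3.89)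
factors (the shape lit-balaban's carrier-generic ✓ p599614 `thms31to33_cube_of_reg335''` serves), (3.131)∕(3.137) letters + left steps, Z-classed (3.132)∕(3.126)∕(3.152) letters (`LettersRowZT3`,
`Letters313DZ`), FormSmall + Identities, co-readings incl. `CoReadsGlob`, residual (3.46)∕(3.43)–(3.45)} ∧ (BG-336) `ClassTransferT3` ∧ two definitional (115)-pins.
HONEST SCOPE: bookkeeping (one `obtain`, two `exact`); N06(d = 3) NOT discharged; nothing here claims EX, the crux, V3∕R3, d = 4 or the mass gap; rung R3, not Clay.

References: T. Bałaban, CMP **99** (1985) 389–434 [Balaban1985BackgroundPropagators] (Thm 3.3 p.399, Thm 3.10 pp.414–416, p.421, Thm 3.12 p.423, Thm 3.13 p.426, (3.42)–(3.47)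
pp.397–398); CMP **96** (1984) 223–250 [Balaban1984PropagatorsII] (Lemma 2.1 pp.233–234); CMP **102** (1985) 277–309 [Balaban1985Variational] ((117) p.295); CMP **99** (1985) 75–102
[Balaban1985RegularSpaces] ((1.33) p.82).
-/

set_option autoImplicit false

noncomputable section

open scoped Matrix.Norms.L2Operator

namespace Summit.QuantumFields.YangMills.Theorems.Prop7SectET3N06LeavesRelZFromThm310

open Literature.MathematicalPhysics.QuantumFieldTheory.Balaban1983to89
open Literature.MathematicalPhysics.QuantumFieldTheory.Balaban1983to89.T3ContinuumYM3Torus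
open Literature.MathematicalPhysics.QuantumFieldTheory.Balaban1983to89.T3PrintedRegularMinimiser (RegPr)
open Literature.MathematicalPhysics.QuantumFieldTheory.Balaban1983to89.B6KLevelCensusIndexV1 (KIdx)
open Literature.MathematicalPhysics.QuantumFieldTheory.Balaban1983to89.B6GlobalChartV1 (PV)
open Literature.MathematicalPhysics.QuantumFieldTheory.Balaban1983to89.B9GeoNormsKLevelV1 (geo9K)
open Literature.MathematicalPhysics.QuantumFieldTheory.Balaban1983to89.B9Thm34Ext (toB6)
open Literature.MathematicalPhysics.QuantumFieldTheory.Balaban1983to89.B11SectG (BlockNorm HasMaj)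
open Literature.MathematicalPhysics.QuantumFieldTheory.Balaban1983to89.B9Thm37Glue (IsTransposePair)
open Literature.MathematicalPhysics.QuantumFieldTheory.Balaban1983to89.B9CoRealizesRel (CoRealizesRel)
open Literature.MathematicalPhysics.QuantumFieldTheory.Balaban1983to89.B9CoRealizesRelAtLetters (RelB)
open Literature.MathematicalPhysics.QuantumFieldTheory.Balaban1983to89.B9FromB6 (L2Block)
open Literature.MathematicalPhysics.QuantumFieldTheory.Balaban1983to89.B9Thm312Whole (Ops FormSmall cNorm HasRWExpOfOps PosDefKOfOps)
open Literature.MathematicalPhysics.QuantumFieldTheory.Balaban1983to89.B9Thm313WholeLeftZ (Letters313DZ)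
open Literature.MathematicalPhysics.QuantumFieldTheory.Balaban1983to89.B9Ineq347CoReading (CoReadsGlob)
open Literature.MathematicalPhysics.QuantumFieldTheory.Balaban1983to89.B9Thm310Whole (Ops310 StaticOK310 Sizes310 Local342G Identities310)
open Literature.MathematicalPhysics.QuantumFieldTheory.Balaban1983to89.B9RWSums343Holder (HolderProbes HolderLegs310 FactorsHolder310)
open Literature.MathematicalPhysics.QuantumFieldTheory.Balaban1983to89.B9RWSums344InputPair (InputLegsPair310 FactorsInputPair310 DirSupHolder310)
open Literature.MathematicalPhysics.QuantumFieldTheory.Balaban1983to89.B9RWSums346SecondDiff (DirOps310 DirTranspose310 L2SecondLegs310 FactorsL2Second310)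
open Literature.MathematicalPhysics.QuantumFieldTheory.Balaban1983to89.B9RWSums346MixedPair (L2MixedLegs310 FactorsL2Mixed310 DirSup310)
open Literature.MathematicalPhysics.QuantumFieldTheory.Balaban1983to89.B9RWSums346Two (L2TwoLegs310 FactorsL2_310)
open Literature.MathematicalPhysics.QuantumFieldTheory.Balaban1983to89.B9RWSumsDefinitePins (PinPrims)
open Literature.MathematicalPhysics.QuantumFieldTheory.Balaban1983to89.B9RWSumsDefinitePinsPair (PairPrims)
open Literature.MathematicalPhysics.QuantumFieldTheory.Balaban1983to89.B9RWSumsDefinitePinsPairM (MixedPrims)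
open Literature.MathematicalPhysics.QuantumFieldTheory.Balaban1983to89.B9GeoLemma21KLevelV1 (geo9K_len_pos)
open Literature.MathematicalPhysics.QuantumFieldTheory.Balaban1983to89.B9Thm312WholeStepFrom3131 (Letters3131)
open Summit.QuantumFields.YangMills.Theorems.Prop7SectET3Members (hd3 memberIdx)
open Summit.QuantumFields.YangMills.Theorems.Prop7SectET3Geometry (geoOK_geo9K)
open Summit.QuantumFields.YangMills.Theorems.Prop7SectET3BgClass (bgT3 cfgV1OfT3 ClassTransferT3)
open Summit.QuantumFields.YangMills.Theorems.Prop7SectET3Letters (LettersRowZT3)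
open Summit.QuantumFields.YangMills.Theorems.Prop7SectET3NormG (normG_row_of_t313_classTransfer)
open Summit.QuantumFields.YangMills.Theorems.Prop7SectET3N06LeavesRelZ (t313_of_pins_T3_relZ)
open Summit.QuantumFields.YangMills.Theorems.Prop7SectET3G0LayerFromThm310 (g0_layer_T3_of_thm310_schemas)

variable {ℓ : ℕ} {hL : Odd (ℓ + 1) ∧ 1 < ℓ + 1} {b₀ b₁ : ℝ} {c35 : ℝ}

/-! ## §1 The leaf with the G₀ layer discharged by Theorem 3.10's schemas -/

section Leaf

variable [∀ x : KIdx 2 ℓ hd3 hL b₀ b₁, Fintype (geo9K x).Site] [∀ x : KIdx 2 ℓ hd3 hL b₀ b₁, DecidableEq (geo9K x).Site]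

/-- ★★★ **THEOREM 3.13's LEAF AT THE T³ INDEX WITH THE «THEOREM 3.3 FOR G₀» LAYER DISCHARGED BY THEOREM 3.10's SCHEMAS** — `t313_of_pins_T3_relZ` (p603926) ∘
`g0_layer_T3_of_thm310_schemas` (file B): the leaf's `hmodel` (Thm33G0 = (N06-3-1), the two sup-class Steps, FormSmall, Identities) and `hleft` (LeftStep) are NO LONGER displayed; displayed
instead, VERBATIM from file B: the Theorem-3.10 schemas for `G(U) = G₀` at curved U (`h36A` Cor. 3.6 blocks + (3.89) factors + structure identities, `h36HA` legs, `h36A2`), their static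
data ∕ counts ∕ symmetry, the letter identifications, rows 20–21's genuine Sect.-D content (`hrest12`, `hstepD12`, `hL3131`; the G₀D entry `hgD12` IS `hletters`' `gD2` field — discharged),
and the leaf's other inputs (`hcoR hco1R` relative to `RelB`, `hcoG`, `wZ`, `hletters = LettersRowZT3 …`, `hlettersD` (`Letters313DZ`), `hres`, pins) at the regime `(M12, a12)`; the leaf is then read at `(M₁, a₁, B₀, δ₀, θ₁, δK, r₁, θD)
:= (M₀, a₀, B12₀, δ12₀, θ12, δK12, r12, θD12)` of file B (thresholds `max`, radii `min` inside file B; `hlen` proofs agree by proof irrelevance).  Conclusion VERBATIM: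
`B9.Thm313Printed c35 geo9K bgT3 GG HasRWExp PosDefK`.  Nothing of print asserted.
[cite: Balaban1985BackgroundPropagators, Thm 3.13 p.426, Thm 3.12 p.423, Thm 3.10 (3.105)-(3.108) pp.414-416, Thm 3.3 p.399, p.421, (3.42)-(3.47) pp.397-398; Balaban1984PropagatorsII, Lemma 2.1 (2.59)-(2.61) pp.233-234] -/
theorem t313_of_pins_T3_relZ_fromThm310 {X Y ι A PX PY Z W : KIdx 2 ℓ hd3 hL b₀ b₁ → Type} {P : KIdx 2 ℓ hd3 hL b₀ b₁ → Type}
    [∀ x, Fintype (X x)] [∀ x, DecidableEq (X x)] [∀ x, Fintype (Y x)] [∀ x, DecidableEq (Y x)] [∀ x, Fintype (ι x)]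
    [∀ x, Fintype (A x)] [∀ x, Fintype (PX x)] [∀ x, DecidableEq (PX x)] [∀ x, Fintype (PY x)] [∀ x, DecidableEq (PY x)]
    [∀ x, Fintype (Z x)] [∀ x, Fintype (W x)]
    (hc35 : 0 < c35) (q : PinPrims) (hq : q.OK) (q3 : PairPrims) (hq3 : q3.OK) (qM : MixedPrims) (hqM : qM.OK)
    (H : KIdx 2 ℓ hd3 hL b₀ b₁ → Prop)
    -- the Theorem-3.10 letters of rows 18–19 (G side) and their schemas, VERBATIM as the certificate displays them
    (𝔬A : ∀ x : KIdx 2 ℓ hd3 hL b₀ b₁, Ops310 (geo9K x) (bgT3 x) (X x) (Y x) (ι x) (A x))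
    (𝔭A : ∀ x : KIdx 2 ℓ hd3 hL b₀ b₁, HolderProbes (geo9K x) (bgT3 x) (X x) (Y x) (PX x) (PY x))
    (𝔡A : ∀ x : KIdx 2 ℓ hd3 hL b₀ b₁, DirOps310 (𝔬A x) (P x))
    (bHXA : ∀ x : KIdx 2 ℓ hd3 hL b₀ b₁, ℝ → BlockNorm (toB6 (geo9K x) 1 (H x)) (X x → ℝ))
    (κA : KIdx 2 ℓ hd3 hL b₀ b₁ → Sizes310)
    (SHA S3A SIA SMA S2A : ∀ x : KIdx 2 ℓ hd3 hL b₀ b₁, ι x → Finset (geo9K x).Site)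
    (hstA : ∀ x, StaticOK310 (𝔬A x) q.ρ q.Nc q.N' q.NF q.Cℓ (κA x)) (hκA : ∀ x, (κA x).Bounded q.Kc)
    (h36A : ∀ x, q.M₁ ≤ (geo9K x).M → ∀ α₀ : ℝ, 0 < α₀ → c35 * (geo9K x).M * α₀ ≤ q.a₁ →
      ∀ U : (bgT3 x).Cfg, (bgT3 x).Reg335 c35 α₀ U →
        Local342G (𝔬A x) 1 (H x) q.B₀ q.δ₀ U ∧ B9Thm310Whole.Factors389 (𝔬A x) 1 (H x) q.θ₀ q.δ₀ U ∧
          Identities310 (𝔬A x) 1 (H x) U)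
    (h36HA : ∀ x, q.M₁ ≤ (geo9K x).M → ∀ α₀ : ℝ, 0 < α₀ → c35 * (geo9K x).M * α₀ ≤ q.a₁ →
      ∀ U : (bgT3 x).Cfg, (bgT3 x).Reg335 c35 α₀ U →
        HolderLegs310 (𝔬A x) (𝔭A x) 1 (H x) (SHA x) q.Bl q.δ₀ U ∧ FactorsHolder310 (𝔬A x) (𝔭A x) 1 (H x) q.Bt q.δ₀ U ∧
          (L2SecondLegs310 (𝔬A x) (𝔡A x) 1 (H x) (S3A x) q3.B3 q.δ₀ U ∧ FactorsL2Second310 (𝔬A x) (𝔡A x) 1 (H x) q3.θ3 q.δ₀ U ∧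
            DirTranspose310 (𝔬A x) (𝔡A x) U) ∧
            (InputLegsPair310 (𝔬A x) (𝔡A x) (𝔭A x) 1 (H x) (bHXA x) (SIA x) q.BI q.BI2 q.δ₀ U ∧
              FactorsInputPair310 (𝔬A x) (𝔡A x) 1 (H x) (bHXA x) q.θI q.δ₀ U ∧ DirSupHolder310 (𝔬A x) (𝔡A x) (𝔭A x) 1 (H x) U) ∧
              (L2MixedLegs310 (𝔬A x) (𝔡A x) 1 (H x) (SMA x) qM.BM q.δ₀ U ∧ FactorsL2Mixed310 (𝔬A x) (𝔡A x) 1 (H x) qM.θM q.δ₀ U ∧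
                DirSup310 (𝔬A x) (𝔡A x) 1 (H x) U))
    -- the two-sided L² leg schema of Theorem 3.10 (the (3.46)₄ line of G(U) = ∇_UG∇*_U: n06-k's one-slot legs + their factors)
    (h36A2 : ∀ x, q.M₁ ≤ (geo9K x).M → ∀ α₀ : ℝ, 0 < α₀ → c35 * (geo9K x).M * α₀ ≤ q.a₁ →
      ∀ U : (bgT3 x).Cfg, (bgT3 x).Reg335 c35 α₀ U →
        L2TwoLegs310 (𝔬A x) 1 (H x) (S2A x) q.B2 q.δ₀ U ∧ FactorsL2_310 (𝔬A x) 1 (H x) q.θ2 q.δ₀ U)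
    (hcntHA : ∀ x (a : (geo9K x).Site), (∑ c, if a ∈ SHA x c then (1 : ℝ) else 0) ≤ q.NH)
    (hcnt3A : ∀ x (a : (geo9K x).Site), (∑ c, if a ∈ S3A x c then (1 : ℝ) else 0) ≤ q3.N3)
    (hcntIA : ∀ x (a : (geo9K x).Site), (∑ c, if a ∈ SIA x c then (1 : ℝ) else 0) ≤ q.NI)
    (hcntMA : ∀ x (a : (geo9K x).Site), (∑ c, if a ∈ SMA x c then (1 : ℝ) else 0) ≤ qM.NM)
    (hcnt2A : ∀ x (a : (geo9K x).Site), (∑ c, if a ∈ S2A x c then (1 : ℝ) else 0) ≤ q.N2)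
    -- the symmetry of G(U) and the transposition (∇_UG)ᵀ = G∇*_U (theorems at the pins in the certificate)
    (hsymA : ∀ x, q.M₁ ≤ (geo9K x).M → ∀ α₀ : ℝ, 0 < α₀ → c35 * (geo9K x).M * α₀ ≤ q.a₁ →
      ∀ U : (bgT3 x).Cfg, (bgT3 x).Reg335 c35 α₀ U → IsTransposePair ((𝔬A x).G U) ((𝔬A x).G U))
    (htrA : ∀ x, q.M₁ ≤ (geo9K x).M → ∀ α₀ : ℝ, 0 < α₀ → c35 * (geo9K x).M * α₀ ≤ q.a₁ →
      ∀ U : (bgT3 x).Cfg, (bgT3 x).Reg335 c35 α₀ U →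
        IsTransposePair ((𝔬A x).D U ∘ₗ (𝔬A x).G U) ((𝔬A x).G U ∘ₗ (𝔬A x).Dstar U))
    -- the Theorem-3.12 letters of rows 20–21 and the identification G₀ := G(U) (p. 421; at def-Y's pins: the same coordinate models)
    (𝔬12 : ∀ x : KIdx 2 ℓ hd3 hL b₀ b₁, B9Thm312Whole.Ops (geo9K x) (bgT3 x) (X x) (Y x) (Z x) (W x))
    (hblk : ∀ x, (𝔬12 x).blk = (𝔬A x).blk) (hblkY : ∀ x, (𝔬12 x).blkY = (𝔬A x).blkY)
    (hG0 : ∀ x (U : (bgT3 x).Cfg), (𝔬12 x).G0 U = (𝔬A x).G U) (hD : ∀ x (U : (bgT3 x).Cfg), (𝔬12 x).D U = (𝔬A x).D U)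
    (hDs : ∀ x (U : (bgT3 x).Cfg), (𝔬12 x).Dstar U = (𝔬A x).Dstar U)
    -- rows 20–21's numerics and the ONE rate relation
    (θD12 r12 δ12₀ δK12 a12 M12 B₃ δ₃ t12 δT12 ρS σS : ℝ) (ha12 : 0 < a12) (hM12 : 0 < M12) (hθD12 : 0 ≤ θD12) (hr12 : 0 ≤ r12)
    (hδ12₀ : δ12₀ ≤ (1 - 3 * q.αF) * ((1 - 2 * q.α) * q.δ₀)) (hB₃ : 0 ≤ B₃) (ht12 : 0 ≤ t12)
    -- the rates of the derived sup-class steps: a working rate ρS ≤ δT12 with ρS + σS ≤ min(δ12₀, δ₃) ([4] (2.61) at rate σS > 0) and δK12 + α_Fδ ≤ ρS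
    (hσS : 0 < σS) (hρS : 0 ≤ ρS) (hρST : ρS ≤ δT12) (hρS₀ : ρS + σS ≤ δ12₀) (hρS₃ : ρS + σS ≤ δ₃)
    (hδKS : δK12 + q.αF * ((1 - 2 * q.α) * q.δ₀) ≤ ρS)
    -- rows 20–21's GENUINE Sect.-D content in Theorem 3.12's regime: the steps, the form smallness, the identities, the two left steps
    (hrest12 : ∀ x : KIdx 2 ℓ hd3 hL b₀ b₁, M12 ≤ (geo9K x).M → ∀ α₀ : ℝ, 0 < α₀ → (geo9K x).M * α₀ ≤ a12 →
      ∀ U : (bgT3 x).Cfg, (bgT3 x).Reg335 c35 α₀ U → (bgT3 x).Reg336 c35 α₀ U →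
        FormSmall (𝔬12 x) (r12 * ((geo9K x).M * α₀)) U ∧ B9Thm312Whole.Identities (𝔬12 x) U)
    -- print's (3.131) ∕ (3.137): Δ′_π = T_a + D·T_b, Δ⁽²⁾_π = T_a₂ + D·T_b₂ with small local majorants t·e^{−δ_T d} (n06-l g11 `Letters3131`; FREE letters)
    (Ta Ta₂ : ∀ x : KIdx 2 ℓ hd3 hL b₀ b₁, (bgT3 x).Cfg → Module.End ℝ (X x → ℝ))
    (Tb Tb₂ : ∀ x : KIdx 2 ℓ hd3 hL b₀ b₁, (bgT3 x).Cfg → (X x → ℝ) →ₗ[ℝ] (W x → ℝ))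
    (hL3131 : ∀ x : KIdx 2 ℓ hd3 hL b₀ b₁, M12 ≤ (geo9K x).M → ∀ α₀ : ℝ, 0 < α₀ → (geo9K x).M * α₀ ≤ a12 →
      ∀ U : (bgT3 x).Cfg, (bgT3 x).Reg335 c35 α₀ U → (bgT3 x).Reg336 c35 α₀ U →
        Letters3131 (𝔬12 x) (Ta x) (Ta₂ x) (Tb x) (Tb₂ x) 1 (H x) (fun y => (geo9K_len_pos x y).le) (t12 * ((geo9K x).M * α₀)) δT12 U)
    (hstepD12 : ∀ x : KIdx 2 ℓ hd3 hL b₀ b₁, M12 ≤ (geo9K x).M → ∀ α₀ : ℝ, 0 < α₀ → (geo9K x).M * α₀ ≤ a12 →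
      ∀ U : (bgT3 x).Cfg, (bgT3 x).Reg335 c35 α₀ U → (bgT3 x).Reg336 c35 α₀ U →
        HasMaj (cNorm 1 (H x) (𝔬12 x).blk (fun y => (geo9K_len_pos x y).le) 2)
            (cNorm 1 (H x) (𝔬12 x).blkY (fun y => (geo9K_len_pos x y).le) 1)
            ((𝔬12 x).D U ∘ₗ (𝔬12 x).G0 U ∘ₗ (𝔬12 x).Tpi U)
            (fun a b => θD12 * ((geo9K x).M * α₀) * Real.exp (-(δK12 * (toB6 (geo9K x) 1 (H x)).dist a b))) ∧
          HasMaj (cNorm 1 (H x) (𝔬12 x).blk (fun y => (geo9K_len_pos x y).le) 2)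
            (cNorm 1 (H x) (𝔬12 x).blkY (fun y => (geo9K_len_pos x y).le) 1)
            ((𝔬12 x).D U ∘ₗ (𝔬12 x).G0 U ∘ₗ ((𝔬12 x).Tpi U + (𝔬12 x).T2 U))
            (fun a b => θD12 * ((geo9K x).M * α₀) * Real.exp (-(δK12 * (toB6 (geo9K x) 1 (H x)).dist a b))))
    -- ======== the Z-species T³ leaf's OTHER displayed inputs (`Prop7SectET3N06LeavesRelZ.t313_of_pins_T3_relZ`), at the regime (M12, a12) ========
    (GG : ∀ x : KIdx 2 ℓ hd3 hL b₀ b₁, B9.KernelFamily (geo9K x) (bgT3 x))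
    (bH : ∀ x : KIdx 2 ℓ hd3 hL b₀ b₁, BlockNorm (toB6 (geo9K x) 1 (H x)) (W x → ℝ))
    (HasRWExp : ∀ x : KIdx 2 ℓ hd3 hL b₀ b₁, B9.KernelFamily (geo9K x) (bgT3 x) → (bgT3 x).Cfg → ℝ → Prop)
    (PosDefK : ∀ x : KIdx 2 ℓ hd3 hL b₀ b₁, B9.KernelFamily (geo9K x) (bgT3 x) → (bgT3 x).Cfg → Prop)
    (ev : ∀ x : KIdx 2 ℓ hd3 hL b₀ b₁, (geo9K x).Loc → X x → ℝ) (evY : ∀ x : KIdx 2 ℓ hd3 hL b₀ b₁, (geo9K x).Loc → Y x → ℝ)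
    (σG ρG ρ'G B₁ δ₁ κ₀ : ℝ) (Bβ Bε : ℝ → ℝ) (Bεβ : ℝ → ℝ → ℝ)
    (hσG : 0 < σG) (hρ'G : 0 < ρ'G) (hρ'ρ : ρ'G + 3 * σG ≤ ρG) (hρG₀ : ρG ≤ δ12₀) (hρG₃ : ρG ≤ δ₃) (hρGK : ρG + σG ≤ δK12)
    (hδ₁ : 0 < δ₁) (hBβ : ∀ β, 0 ≤ Bβ β) (hBε : ∀ ε, 0 ≤ Bε ε) (hBεβ : ∀ ε β, 0 ≤ Bεβ ε β)
    (hκ : ∀ x : KIdx 2 ℓ hd3 hL b₀ b₁, (bH x).κ ≤ κ₀)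
    (hcoR : ∀ (x : KIdx 2 ℓ hd3 hL b₀ b₁) (U : (bgT3 x).Cfg),
      CoRealizesRel (GG x) 0 U (RelB x) (𝔬12 x).blk (𝔬12 x).blk (ev x) ((𝔬12 x).GG U) ∧
      CoRealizesRel (GG x) 2 U (RelB x) (𝔬12 x).blk (𝔬12 x).blkY (evY x) ((𝔬12 x).GG U ∘ₗ (𝔬12 x).Dstar U))
    (hco1R : ∀ (x : KIdx 2 ℓ hd3 hL b₀ b₁) (U : (bgT3 x).Cfg), CoRealizesRel (GG x) 1 U (RelB x) (𝔬12 x).blkY (𝔬12 x).blk (ev x) ((𝔬12 x).D U ∘ₗ (𝔬12 x).GG U))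
    (hcoG : ∀ (x : KIdx 2 ℓ hd3 hL b₀ b₁) (U : (bgT3 x).Cfg),
      CoReadsGlob (GG x) 0 U (𝔬12 x).blk (𝔬12 x).blk (ev x) ((𝔬12 x).GG U) ∧
      CoReadsGlob (GG x) 1 U (𝔬12 x).blkY (𝔬12 x).blk (ev x) ((𝔬12 x).D U ∘ₗ (𝔬12 x).GG U) ∧
      CoReadsGlob (GG x) 2 U (𝔬12 x).blk (𝔬12 x).blkY (evY x) ((𝔬12 x).GG U ∘ₗ (𝔬12 x).Dstar U))
    (wZ : ∀ x : KIdx 2 ℓ hd3 hL b₀ b₁, (geo9K x).Site → ℝ) (hwZ : ∀ x y, 0 < wZ x y)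
    (hletters : LettersRowZT3 𝔬12 (fun _ => 1) H wZ hwZ c35 a12 M12 B₃ δ₃)
    (hlettersD : ∀ x : KIdx 2 ℓ hd3 hL b₀ b₁, M12 ≤ (geo9K x).M → ∀ α₀ : ℝ, 0 < α₀ → (geo9K x).M * α₀ ≤ a12 →
      ∀ U : (bgT3 x).Cfg, (bgT3 x).Reg335 c35 α₀ U → (bgT3 x).Reg336 c35 α₀ U →
        Letters313DZ (𝔬12 x) 1 (H x) (geoOK_geo9K x) (wZ x) (hwZ x) B₃ δ₃ (bH x) U)
    (hres : ∀ x : KIdx 2 ℓ hd3 hL b₀ b₁, M12 ≤ (geo9K x).M → ∀ α₀ : ℝ, 0 < α₀ → (geo9K x).M * α₀ ≤ a12 →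
      ∀ U : (bgT3 x).Cfg, (bgT3 x).Reg335 c35 α₀ U → (bgT3 x).Reg336 c35 α₀ U →
        L2Block (GG x) B₁ δ₁ U ∧ B9.Ineq343_345 (GG x) Bβ Bε Bεβ δ₁ U)
    (hpinE : ∀ x : KIdx 2 ℓ hd3 hL b₀ b₁, HasRWExp x = HasRWExpOfOps (𝔬12 x)) (hpinK : ∀ x : KIdx 2 ℓ hd3 hL b₀ b₁, PosDefK x = PosDefKOfOps (𝔬12 x)) :
    B9.Thm313Printed c35 geo9K bgT3 GG HasRWExp PosDefK := by
  obtain ⟨B12₀, Bh12, Bi12, Bi2₁₂, B12₂, θ12, M₀, a₀, hB12₀, -, -, -, -, hθ12, hM₀, ha₀, hM12M₀, ha₀a12, hmodel', hleft', -⟩ :=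
    g0_layer_T3_of_thm310_schemas (bg := bgT3) hc35 q hq q3 hq3 qM hqM H 𝔬A 𝔭A 𝔡A bHXA κA SHA S3A SIA SMA S2A hstA hκA h36A h36HA h36A2
      hcntHA hcnt3A hcntIA hcntMA hcnt2A hsymA htrA 𝔬12 hblk hblkY hG0 hD hDs θD12 r12 δ12₀ δK12 a12 M12 B₃ δ₃ t12 δT12 ρS σS ha12 hM12 hδ12₀
      hB₃ ht12 hσS hρS hρST hρS₀ hρS₃ hδKS hrest12 (fun x hM α₀ hα₀ hMa U hU hU' => (hletters x hM α₀ hα₀ hMa U hU hU').gD2) Ta Ta₂ Tb Tb₂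
      hL3131 hstepD12
  exact t313_of_pins_T3_relZ 𝔬12 H GG bH HasRWExp PosDefK ev evY c35 θ12 θD12 r12 B12₀ δ12₀ δK12 σG ρG a₀ M₀ B₁ δ₁ B₃ δ₃ ρ'G κ₀ Bβ Bε Bεβ
    hθ12 hθD12 hr12 hB12₀ hB₃ hσG hρ'G hρ'ρ hρG₀ hρG₃ hρGK ha₀ hM₀ hδ₁ hBβ hBε hBεβ hκ hcoR hco1R hcoG
    (fun x hM α₀ hα₀ hMa U hU hU' => hmodel' x hM α₀ hα₀ hMa U hU hU')
    (fun x hM α₀ hα₀ hMa U hU hU' => hleft' x hM α₀ hα₀ hMa U hU hU') wZ hwZ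
    (fun x hM α₀ hα₀ hMa U hU hU' => hletters x (hM12M₀.trans hM) α₀ hα₀ (hMa.trans ha₀a12) U hU hU')
    (fun x hM α₀ hα₀ hMa U hU hU' => hlettersD x (hM12M₀.trans hM) α₀ hα₀ (hMa.trans ha₀a12) U hU hU')
    (fun x hM α₀ hα₀ hMa U hU hU' => hres x (hM12M₀.trans hM) α₀ hα₀ (hMa.trans ha₀a12) U hU hU') hpinE hpinK

end Leaf

/-! ## §2 The `norm_G` row from Theorem 3.10's schemas — one kernel statement -/

section NormG

variable [∀ x : KIdx 2 ℓ hd3 hL 1 1, Fintype (geo9K x).Site] [∀ x : KIdx 2 ℓ hd3 hL 1 1, DecidableEq (geo9K x).Site]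

/-- ★★★ **THE `norm_G` ROW OF C-min FROM THEOREM 3.10's SCHEMAS + THE SECT.-D LETTERS + (BG-336) + THE TWO (115)-PINS — ONE KERNEL STATEMENT** (`normG_row_of_t313_classTransfer`
(✓ p600795) ∘ `t313_of_pins_T3_fromThm310`, band `b₀ = b₁ = 1` of `memberIdx`, pins `HasRWExpOfOps`∕`PosDefKOfOps`): the displayed inputs of §1 + ★w1 g2's `ClassTransferT3 ℓ hL c35` +
an operator family `Gop x U : Xo x U → Yo x U` read by `GG`'s (3.47) entries (`hw`, `hglob`) give `M₄, a₀, B₀′ > 0` with, for every member `memberIdx ℓ hL hℓ m hm n K a' R …` whose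
`M = L·L^{a'}` clears `M₄`, every `e ≤ a₀∕(L·L^{a'})`, every SU(2) field `U₀ ∈ RegPr ⟨ℓ+1, hL, m, hm⟩ n K e` and every `f`: `‖Gop (memberIdx …) (cfgV1OfT3 U₀) f‖ ≤ B₀′‖f‖` — the displayed
`norm_G` row of `Cmin_of_P6T3_chart_growth_pd` in its own shape.  Its N06(d = 3) content is now, BY NAME: Theorem 3.10's walk-expansion schemas for `G₀ = G(U)` at curved U (Cor. 3.6 per
cube + (3.89) factors + legs), print's (3.131)∕(3.137) letters and left steps, the Z-classed (3.132)∕(3.126)∕(3.152) letters (`LettersRowZT3`, `Letters313DZ`), form smallness + identities, the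
co-readings, the residual (3.46)∕(3.43)–(3.45), and the class transfer (BG-336).  Nothing of print asserted; NOT a discharge of N06(d = 3).
[cite: Balaban1985Variational, (117) p.295; Balaban1985BackgroundPropagators, Thm 3.13 p.426, Thm 3.10 pp.414-416, (3.47) p.398; Balaban1985RegularSpaces, (1.33) p.82] -/
theorem normG_row_of_thm310ObligationsZ {X Y ι A PX PY Z W : KIdx 2 ℓ hd3 hL 1 1 → Type} {P : KIdx 2 ℓ hd3 hL 1 1 → Type}
    [∀ x, Fintype (X x)] [∀ x, DecidableEq (X x)] [∀ x, Fintype (Y x)] [∀ x, DecidableEq (Y x)] [∀ x, Fintype (ι x)]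
    [∀ x, Fintype (A x)] [∀ x, Fintype (PX x)] [∀ x, DecidableEq (PX x)] [∀ x, Fintype (PY x)] [∀ x, DecidableEq (PY x)]
    [∀ x, Fintype (Z x)] [∀ x, Fintype (W x)]
    (hc35 : 0 < c35) (q : PinPrims) (hq : q.OK) (q3 : PairPrims) (hq3 : q3.OK) (qM : MixedPrims) (hqM : qM.OK)
    (H : KIdx 2 ℓ hd3 hL 1 1 → Prop)
    -- the Theorem-3.10 letters of rows 18–19 (G side) and their schemas, VERBATIM as the certificate displays them
    (𝔬A : ∀ x : KIdx 2 ℓ hd3 hL 1 1, Ops310 (geo9K x) (bgT3 x) (X x) (Y x) (ι x) (A x))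
    (𝔭A : ∀ x : KIdx 2 ℓ hd3 hL 1 1, HolderProbes (geo9K x) (bgT3 x) (X x) (Y x) (PX x) (PY x))
    (𝔡A : ∀ x : KIdx 2 ℓ hd3 hL 1 1, DirOps310 (𝔬A x) (P x))
    (bHXA : ∀ x : KIdx 2 ℓ hd3 hL 1 1, ℝ → BlockNorm (toB6 (geo9K x) 1 (H x)) (X x → ℝ))
    (κA : KIdx 2 ℓ hd3 hL 1 1 → Sizes310)
    (SHA S3A SIA SMA S2A : ∀ x : KIdx 2 ℓ hd3 hL 1 1, ι x → Finset (geo9K x).Site)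
    (hstA : ∀ x, StaticOK310 (𝔬A x) q.ρ q.Nc q.N' q.NF q.Cℓ (κA x)) (hκA : ∀ x, (κA x).Bounded q.Kc)
    (h36A : ∀ x, q.M₁ ≤ (geo9K x).M → ∀ α₀ : ℝ, 0 < α₀ → c35 * (geo9K x).M * α₀ ≤ q.a₁ →
      ∀ U : (bgT3 x).Cfg, (bgT3 x).Reg335 c35 α₀ U →
        Local342G (𝔬A x) 1 (H x) q.B₀ q.δ₀ U ∧ B9Thm310Whole.Factors389 (𝔬A x) 1 (H x) q.θ₀ q.δ₀ U ∧
          Identities310 (𝔬A x) 1 (H x) U)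
    (h36HA : ∀ x, q.M₁ ≤ (geo9K x).M → ∀ α₀ : ℝ, 0 < α₀ → c35 * (geo9K x).M * α₀ ≤ q.a₁ →
      ∀ U : (bgT3 x).Cfg, (bgT3 x).Reg335 c35 α₀ U →
        HolderLegs310 (𝔬A x) (𝔭A x) 1 (H x) (SHA x) q.Bl q.δ₀ U ∧ FactorsHolder310 (𝔬A x) (𝔭A x) 1 (H x) q.Bt q.δ₀ U ∧
          (L2SecondLegs310 (𝔬A x) (𝔡A x) 1 (H x) (S3A x) q3.B3 q.δ₀ U ∧ FactorsL2Second310 (𝔬A x) (𝔡A x) 1 (H x) q3.θ3 q.δ₀ U ∧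
            DirTranspose310 (𝔬A x) (𝔡A x) U) ∧
            (InputLegsPair310 (𝔬A x) (𝔡A x) (𝔭A x) 1 (H x) (bHXA x) (SIA x) q.BI q.BI2 q.δ₀ U ∧
              FactorsInputPair310 (𝔬A x) (𝔡A x) 1 (H x) (bHXA x) q.θI q.δ₀ U ∧ DirSupHolder310 (𝔬A x) (𝔡A x) (𝔭A x) 1 (H x) U) ∧
              (L2MixedLegs310 (𝔬A x) (𝔡A x) 1 (H x) (SMA x) qM.BM q.δ₀ U ∧ FactorsL2Mixed310 (𝔬A x) (𝔡A x) 1 (H x) qM.θM q.δ₀ U ∧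
                DirSup310 (𝔬A x) (𝔡A x) 1 (H x) U))
    -- the two-sided L² leg schema of Theorem 3.10 (the (3.46)₄ line of G(U) = ∇_UG∇*_U: n06-k's one-slot legs + their factors)
    (h36A2 : ∀ x, q.M₁ ≤ (geo9K x).M → ∀ α₀ : ℝ, 0 < α₀ → c35 * (geo9K x).M * α₀ ≤ q.a₁ →
      ∀ U : (bgT3 x).Cfg, (bgT3 x).Reg335 c35 α₀ U →
        L2TwoLegs310 (𝔬A x) 1 (H x) (S2A x) q.B2 q.δ₀ U ∧ FactorsL2_310 (𝔬A x) 1 (H x) q.θ2 q.δ₀ U)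
    (hcntHA : ∀ x (a : (geo9K x).Site), (∑ c, if a ∈ SHA x c then (1 : ℝ) else 0) ≤ q.NH)
    (hcnt3A : ∀ x (a : (geo9K x).Site), (∑ c, if a ∈ S3A x c then (1 : ℝ) else 0) ≤ q3.N3)
    (hcntIA : ∀ x (a : (geo9K x).Site), (∑ c, if a ∈ SIA x c then (1 : ℝ) else 0) ≤ q.NI)
    (hcntMA : ∀ x (a : (geo9K x).Site), (∑ c, if a ∈ SMA x c then (1 : ℝ) else 0) ≤ qM.NM)
    (hcnt2A : ∀ x (a : (geo9K x).Site), (∑ c, if a ∈ S2A x c then (1 : ℝ) else 0) ≤ q.N2)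
    -- the symmetry of G(U) and the transposition (∇_UG)ᵀ = G∇*_U (theorems at the pins in the certificate)
    (hsymA : ∀ x, q.M₁ ≤ (geo9K x).M → ∀ α₀ : ℝ, 0 < α₀ → c35 * (geo9K x).M * α₀ ≤ q.a₁ →
      ∀ U : (bgT3 x).Cfg, (bgT3 x).Reg335 c35 α₀ U → IsTransposePair ((𝔬A x).G U) ((𝔬A x).G U))
    (htrA : ∀ x, q.M₁ ≤ (geo9K x).M → ∀ α₀ : ℝ, 0 < α₀ → c35 * (geo9K x).M * α₀ ≤ q.a₁ →
      ∀ U : (bgT3 x).Cfg, (bgT3 x).Reg335 c35 α₀ U →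
        IsTransposePair ((𝔬A x).D U ∘ₗ (𝔬A x).G U) ((𝔬A x).G U ∘ₗ (𝔬A x).Dstar U))
    -- the Theorem-3.12 letters of rows 20–21 and the identification G₀ := G(U) (p. 421; at def-Y's pins: the same coordinate models)
    (𝔬12 : ∀ x : KIdx 2 ℓ hd3 hL 1 1, B9Thm312Whole.Ops (geo9K x) (bgT3 x) (X x) (Y x) (Z x) (W x))
    (hblk : ∀ x, (𝔬12 x).blk = (𝔬A x).blk) (hblkY : ∀ x, (𝔬12 x).blkY = (𝔬A x).blkY)
    (hG0 : ∀ x (U : (bgT3 x).Cfg), (𝔬12 x).G0 U = (𝔬A x).G U) (hD : ∀ x (U : (bgT3 x).Cfg), (𝔬12 x).D U = (𝔬A x).D U)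
    (hDs : ∀ x (U : (bgT3 x).Cfg), (𝔬12 x).Dstar U = (𝔬A x).Dstar U)
    -- rows 20–21's numerics and the ONE rate relation
    (θD12 r12 δ12₀ δK12 a12 M12 B₃ δ₃ t12 δT12 ρS σS : ℝ) (ha12 : 0 < a12) (hM12 : 0 < M12) (hθD12 : 0 ≤ θD12) (hr12 : 0 ≤ r12)
    (hδ12₀ : δ12₀ ≤ (1 - 3 * q.αF) * ((1 - 2 * q.α) * q.δ₀)) (hB₃ : 0 ≤ B₃) (ht12 : 0 ≤ t12)
    -- the rates of the derived sup-class steps: a working rate ρS ≤ δT12 with ρS + σS ≤ min(δ12₀, δ₃) ([4] (2.61) at rate σS > 0) and δK12 + α_Fδ ≤ ρS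
    (hσS : 0 < σS) (hρS : 0 ≤ ρS) (hρST : ρS ≤ δT12) (hρS₀ : ρS + σS ≤ δ12₀) (hρS₃ : ρS + σS ≤ δ₃)
    (hδKS : δK12 + q.αF * ((1 - 2 * q.α) * q.δ₀) ≤ ρS)
    -- rows 20–21's GENUINE Sect.-D content in Theorem 3.12's regime: the steps, the form smallness, the identities, the two left steps
    (hrest12 : ∀ x : KIdx 2 ℓ hd3 hL 1 1, M12 ≤ (geo9K x).M → ∀ α₀ : ℝ, 0 < α₀ → (geo9K x).M * α₀ ≤ a12 →
      ∀ U : (bgT3 x).Cfg, (bgT3 x).Reg335 c35 α₀ U → (bgT3 x).Reg336 c35 α₀ U →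
        FormSmall (𝔬12 x) (r12 * ((geo9K x).M * α₀)) U ∧ B9Thm312Whole.Identities (𝔬12 x) U)
    -- print's (3.131) ∕ (3.137): Δ′_π = T_a + D·T_b, Δ⁽²⁾_π = T_a₂ + D·T_b₂ with small local majorants t·e^{−δ_T d} (n06-l g11 `Letters3131`; FREE letters)
    (Ta Ta₂ : ∀ x : KIdx 2 ℓ hd3 hL 1 1, (bgT3 x).Cfg → Module.End ℝ (X x → ℝ))
    (Tb Tb₂ : ∀ x : KIdx 2 ℓ hd3 hL 1 1, (bgT3 x).Cfg → (X x → ℝ) →ₗ[ℝ] (W x → ℝ))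
    (hL3131 : ∀ x : KIdx 2 ℓ hd3 hL 1 1, M12 ≤ (geo9K x).M → ∀ α₀ : ℝ, 0 < α₀ → (geo9K x).M * α₀ ≤ a12 →
      ∀ U : (bgT3 x).Cfg, (bgT3 x).Reg335 c35 α₀ U → (bgT3 x).Reg336 c35 α₀ U →
        Letters3131 (𝔬12 x) (Ta x) (Ta₂ x) (Tb x) (Tb₂ x) 1 (H x) (fun y => (geo9K_len_pos x y).le) (t12 * ((geo9K x).M * α₀)) δT12 U)
    (hstepD12 : ∀ x : KIdx 2 ℓ hd3 hL 1 1, M12 ≤ (geo9K x).M → ∀ α₀ : ℝ, 0 < α₀ → (geo9K x).M * α₀ ≤ a12 →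
      ∀ U : (bgT3 x).Cfg, (bgT3 x).Reg335 c35 α₀ U → (bgT3 x).Reg336 c35 α₀ U →
        HasMaj (cNorm 1 (H x) (𝔬12 x).blk (fun y => (geo9K_len_pos x y).le) 2)
            (cNorm 1 (H x) (𝔬12 x).blkY (fun y => (geo9K_len_pos x y).le) 1)
            ((𝔬12 x).D U ∘ₗ (𝔬12 x).G0 U ∘ₗ (𝔬12 x).Tpi U)
            (fun a b => θD12 * ((geo9K x).M * α₀) * Real.exp (-(δK12 * (toB6 (geo9K x) 1 (H x)).dist a b))) ∧
          HasMaj (cNorm 1 (H x) (𝔬12 x).blk (fun y => (geo9K_len_pos x y).le) 2)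
            (cNorm 1 (H x) (𝔬12 x).blkY (fun y => (geo9K_len_pos x y).le) 1)
            ((𝔬12 x).D U ∘ₗ (𝔬12 x).G0 U ∘ₗ ((𝔬12 x).Tpi U + (𝔬12 x).T2 U))
            (fun a b => θD12 * ((geo9K x).M * α₀) * Real.exp (-(δK12 * (toB6 (geo9K x) 1 (H x)).dist a b))))
    -- ======== the Z-species T³ leaf's OTHER displayed inputs (`Prop7SectET3N06LeavesRelZ.t313_of_pins_T3_relZ`), at the regime (M12, a12) ========
    (GG : ∀ x : KIdx 2 ℓ hd3 hL 1 1, B9.KernelFamily (geo9K x) (bgT3 x))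
    (bH : ∀ x : KIdx 2 ℓ hd3 hL 1 1, BlockNorm (toB6 (geo9K x) 1 (H x)) (W x → ℝ))
    (ev : ∀ x : KIdx 2 ℓ hd3 hL 1 1, (geo9K x).Loc → X x → ℝ) (evY : ∀ x : KIdx 2 ℓ hd3 hL 1 1, (geo9K x).Loc → Y x → ℝ)
    (σG ρG ρ'G B₁ δ₁ κ₀ : ℝ) (Bβ Bε : ℝ → ℝ) (Bεβ : ℝ → ℝ → ℝ)
    (hσG : 0 < σG) (hρ'G : 0 < ρ'G) (hρ'ρ : ρ'G + 3 * σG ≤ ρG) (hρG₀ : ρG ≤ δ12₀) (hρG₃ : ρG ≤ δ₃) (hρGK : ρG + σG ≤ δK12)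
    (hδ₁ : 0 < δ₁) (hBβ : ∀ β, 0 ≤ Bβ β) (hBε : ∀ ε, 0 ≤ Bε ε) (hBεβ : ∀ ε β, 0 ≤ Bεβ ε β)
    (hκ : ∀ x : KIdx 2 ℓ hd3 hL 1 1, (bH x).κ ≤ κ₀)
    (hcoR : ∀ (x : KIdx 2 ℓ hd3 hL 1 1) (U : (bgT3 x).Cfg),
      CoRealizesRel (GG x) 0 U (RelB x) (𝔬12 x).blk (𝔬12 x).blk (ev x) ((𝔬12 x).GG U) ∧
      CoRealizesRel (GG x) 2 U (RelB x) (𝔬12 x).blk (𝔬12 x).blkY (evY x) ((𝔬12 x).GG U ∘ₗ (𝔬12 x).Dstar U))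
    (hco1R : ∀ (x : KIdx 2 ℓ hd3 hL 1 1) (U : (bgT3 x).Cfg), CoRealizesRel (GG x) 1 U (RelB x) (𝔬12 x).blkY (𝔬12 x).blk (ev x) ((𝔬12 x).D U ∘ₗ (𝔬12 x).GG U))
    (hcoG : ∀ (x : KIdx 2 ℓ hd3 hL 1 1) (U : (bgT3 x).Cfg),
      CoReadsGlob (GG x) 0 U (𝔬12 x).blk (𝔬12 x).blk (ev x) ((𝔬12 x).GG U) ∧
      CoReadsGlob (GG x) 1 U (𝔬12 x).blkY (𝔬12 x).blk (ev x) ((𝔬12 x).D U ∘ₗ (𝔬12 x).GG U) ∧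
      CoReadsGlob (GG x) 2 U (𝔬12 x).blk (𝔬12 x).blkY (evY x) ((𝔬12 x).GG U ∘ₗ (𝔬12 x).Dstar U))
    (wZ : ∀ x : KIdx 2 ℓ hd3 hL 1 1, (geo9K x).Site → ℝ) (hwZ : ∀ x y, 0 < wZ x y)
    (hletters : LettersRowZT3 𝔬12 (fun _ => 1) H wZ hwZ c35 a12 M12 B₃ δ₃)
    (hlettersD : ∀ x : KIdx 2 ℓ hd3 hL 1 1, M12 ≤ (geo9K x).M → ∀ α₀ : ℝ, 0 < α₀ → (geo9K x).M * α₀ ≤ a12 →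
      ∀ U : (bgT3 x).Cfg, (bgT3 x).Reg335 c35 α₀ U → (bgT3 x).Reg336 c35 α₀ U →
        Letters313DZ (𝔬12 x) 1 (H x) (geoOK_geo9K x) (wZ x) (hwZ x) B₃ δ₃ (bH x) U)
    (hres : ∀ x : KIdx 2 ℓ hd3 hL 1 1, M12 ≤ (geo9K x).M → ∀ α₀ : ℝ, 0 < α₀ → (geo9K x).M * α₀ ≤ a12 →
      ∀ U : (bgT3 x).Cfg, (bgT3 x).Reg335 c35 α₀ U → (bgT3 x).Reg336 c35 α₀ U →
        L2Block (GG x) B₁ δ₁ U ∧ B9.Ineq343_345 (GG x) Bβ Bε Bεβ δ₁ U)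
    -- ======== the class-transfer row (BG-336) and the operator family read by `GG`'s (3.47) entries at `γ = −3` (`Prop7SectET3NormG`) ========
    (hCT : ClassTransferT3 ℓ hL c35)
    {Xo Yo : ∀ x : KIdx 2 ℓ hd3 hL 1 1, (bgT3 x).Cfg → Type} [∀ x U, SeminormedAddCommGroup (Xo x U)] [∀ x U, SeminormedAddCommGroup (Yo x U)]
    (Gop : ∀ (x : KIdx 2 ℓ hd3 hL 1 1) (U : (bgT3 x).Cfg), Xo x U → Yo x U) (ιo : ∀ (x : KIdx 2 ℓ hd3 hL 1 1) (U : (bgT3 x).Cfg), Xo x U → (geo9K x).Loc)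
    (hw : ∀ (x : KIdx 2 ℓ hd3 hL 1 1) (U : (bgT3 x).Cfg) (f : Xo x U), (geo9K x).wNorm (-3) (ιo x U f) ≤ ‖f‖)
    (hglob : ∀ (x : KIdx 2 ℓ hd3 hL 1 1) (U : (bgT3 x).Cfg) (f : Xo x U), ‖Gop x U f‖ ≤ max ((GG x).glob 0 U (ιo x U f) (-3)) ((GG x).glob 1 U (ιo x U f) (-3))) :
    ∃ M₄ a₀ B₀' : ℝ, 0 < M₄ ∧ 0 < a₀ ∧ 0 < B₀' ∧
      ∀ (hℓ : 4 ≤ ℓ) (m : ℕ) (hm : 1 ≤ m) (n K a' R : ℕ) (hk1 : 1 ≤ K - n) (hsize : a' + 3 ≤ m + n) (hM8 : 8 ≤ (ℓ + 1) ^ a') (hR2 : 2 * (ℓ + 1) ^ 2 ≤ R),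
        M₄ ≤ ((ℓ + 1 : ℕ) : ℝ) * (((ℓ + 1) ^ a' : ℕ) : ℝ) →
        ∀ (e : ℝ) (U₀ : GaugeField (PV 2 ℓ m K hd3 hL) 0 (Matrix.specialUnitaryGroup (Fin 2) ℂ)),
          RegPr (⟨ℓ + 1, hL, m, hm⟩ : T3Family) n K e U₀ → e ≤ a₀ / (((ℓ + 1 : ℕ) : ℝ) * (((ℓ + 1) ^ a' : ℕ) : ℝ)) →
            ∀ f : Xo (memberIdx ℓ hL hℓ m hm n K a' R hk1 hsize hM8 hR2) (cfgV1OfT3 U₀),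
              ‖Gop (memberIdx ℓ hL hℓ m hm n K a' R hk1 hsize hM8 hR2) (cfgV1OfT3 U₀) f‖ ≤ B₀' * ‖f‖ :=
  normG_row_of_t313_classTransfer
    (t313_of_pins_T3_relZ_fromThm310 hc35 q hq q3 hq3 qM hqM H 𝔬A 𝔭A 𝔡A bHXA κA SHA S3A SIA SMA S2A hstA hκA h36A h36HA h36A2 hcntHA hcnt3A hcntIA hcntMA
      hcnt2A hsymA htrA 𝔬12 hblk hblkY hG0 hD hDs θD12 r12 δ12₀ δK12 a12 M12 B₃ δ₃ t12 δT12 ρS σS ha12 hM12 hθD12 hr12 hδ12₀ hB₃ ht12 hσS hρS hρST hρS₀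
      hρS₃ hδKS hrest12 Ta Ta₂ Tb Tb₂ hL3131 hstepD12 GG bH (fun x => HasRWExpOfOps (𝔬12 x)) (fun x => PosDefKOfOps (𝔬12 x)) ev evY σG ρG ρ'G B₁ δ₁ κ₀ Bβ Bε Bεβ
      hσG hρ'G hρ'ρ hρG₀ hρG₃ hρGK hδ₁ hBβ hBε hBεβ hκ hcoR hco1R hcoG wZ hwZ hletters hlettersD hres (fun _ => rfl) (fun _ => rfl))
    hCT Gop ιo hw hglob

end NormG

end Summit.QuantumFields.YangMills.Theorems.Prop7SectET3N06LeavesRelZFromThm310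

end
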